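import Literature.RingTheory.Length.LengthEqFinrank
import Mathlib.Algebra.TrivSqZeroExt.Basic
import Mathlib.RingTheory.Length
import Mathlib.RingTheory.Ideal.Quotient.Basic
import Mathlib.LinearAlgebra.Dimension.Constructions
import HarnessLib

/-!
# The length of `End_R(M)` for a finite-length module: Mukai's Lemma 2.13 AS PRINTED, and a counterexample
# to its equality clause over the square-zero local algebra `k ⊕ k²`

`Literature/RingTheory/Length/EndomorphismLength.lean`, namespace `Literature.RingTheory.Length.Mukai1987Lemma213`.
Family `hodge`; typed by the literature seat `lit-w-mukai` of the venture cell `pub-hsemireg` (Mukai AS PRINTED).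
HONEST FRAMING: pure commutative/linear algebra over an arbitrary field `k`; no variety, sheaf or moduli space occurs;
nothing here bears on the Hodge conjecture. No named fact, no `sorry`; the only definitions are the carrier `W` with its
coordinate plumbing (`W.coord`, `W.e`, `W.mk`), the abbreviation `R`, the instances making `W` an `R`-module, and the
action isomorphism `lsmulEquiv`; everything else is a PROVED theorem.

## The printed statement (verbatim, by eye from the author's scan of the Tata volume, printed p. 358)

[Mukai1987ModuliBundlesK3] S. Mukai, *On the moduli space of bundles on K3 surfaces, I*, Tata Inst. Fund. Res. Stud.
Math. 11 (1987) 341–413, **LEMMA 2.13** (p. 358): «Let `(R, 𝔪)` be a local ring and `M` an artinian `R`-module. Then we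
have `length(End_R(M)) ≥ length(M)`. If equality holds, then `M` is isomorphic to `R/I` for an ideal `I` of `R`.»
PROOF as printed (p. 358–359): «We prove by induction on `length(M)`. Let `M₀` be the submodule `{x ∈ M; 𝔪x = 0}` of `M`.
Every endomorphism of `M` maps `M₀` into itself. Hence we have the exact sequence
`0 → Hom_R(M, M₀) → End_R(M) → End_R(M/M₀) → 0`. Since `M` is artinian, `M₀` is nonzero. Hence by induction
hypothesis, we have `length(End_R(M/M₀)) ≥ length(M/M₀)`. Since `𝔪M₀ = 0`, every homomorphism from `M` to `M₀` factors
through `M/𝔪M`. Hence `Hom_R(M, M₀)` is isomorphic to the vector space `Hom_{R/𝔪}(M/𝔪M, M₀)`. Therefore, we have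
`length(End_R(M)) = length(End_R(M/M₀)) + length(Hom_R(M, M₀)) ≥ length(M/M₀) + length(M/𝔪M) length(M₀) ≥ length(M)`
which shows the first half of the lemma. If equalities hold in the above relations, then we have
`length(End_R(M/M₀)) = length(M/M₀)` and `length(M/𝔪M) = 1`. By the latter equality and the Nakayama's lemma, `M` is
generated by one element. Hence `M` is isomorphic to `R/I` for an ideal `I`.» It is used on p. 359 for **PROPOSITION 2.14**
(«Let `E` be a torsion free sheaf on `S`, `Ẽ` the double dual of `E` and `M = Ẽ/E`. Then we have
`dim Ext¹(Ẽ, Ẽ) + 2 length(M) ≤ dim Ext¹(E, E)`. If equality holds, then the natural map `End(Ẽ) ⊕ End(M) → Hom(Ẽ, M)` is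
surjective and `M` is isomorphic to `𝒪_S/𝒥` for an ideal `𝒥` of `𝒪_S`.», via COROLLARY 2.12).

## What this file PROVES (every field `k`)

Let `R = k ⊕ k²` with `k² · k² = 0` (Mathlib's `TrivSqZeroExt k (Fin 2 → k)`; the local `k`-algebra `k[x, y]/(x, y)²`,
`𝔪 = 0 ⊕ k²`, `𝔪² = 0`), and let `W = k³` with `(a, (s₀, s₁)) • m := a·m + (s₀ m₀ + s₁ m₁)·e₂` (`x ↦ E₃₁`, `y ↦ E₃₂`;
abstractly `W ≅ Hom_k(R, k)`, the Matlis dual of `R` — not used). Then: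
* `R` is local and every element is a scalar modulo `𝔪` (`isLocalRing`, `exists_sub_algebraMap_mem_maximalIdeal`), so
  `length_R = dim_k` on `R`-modules (`Literature.RingTheory.Length.length_eq_finrank_of_residueField`);
* `Module.length R W = 3` (`length_W`), and `W` is an artinian `R`-module (`isArtinian_W`);
* **`lsmulEquiv : R ≃ₗ[R] (W →ₗ[R] W)`** — the action map `r ↦ (m ↦ r • m)` is an ISOMORPHISM of `R`-modules
  (`endo_apply`: every `R`-linear `φ : W → W` is `m ↦ a·m + (c₁ m₀ + c₂ m₁)·e₂` with `a = (φ e₀)₀`, `c₁ = (φ e₀)₂`,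
  `c₂ = (φ e₁)₂`, i.e. the commutant of `{E₃₁, E₃₂}` in `M₃(k)` is `k·1 + k·E₃₁ + k·E₃₂`); hence
  **`length_end_W : Module.length R (W →ₗ[R] W) = 3 = Module.length R W`** — EQUALITY holds in LEMMA 2.13;
* **`not_isCyclic_W`**: no `v ∈ W` generates `W` (`e₀ = r • v` and `e₁ = s • v` force `v₁ = 0` and `(fst s)·v₁ = 1`), and
  **`isEmpty_linearEquiv_quotient`**: for every ideal `I` of `R` there is NO `R`-linear isomorphism `W ≃ R/I`.
So the second sentence of LEMMA 2.13 is FALSE as printed (`theorem Mukai1987_lemma_2_13_equality_clause_fails`), already for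
a module over `R = k[x, y]/(x, y)²` — a quotient of `k[[x, y]]`, i.e. of the local rings `𝒪_{S,s}` of a smooth surface to
which PROPOSITION 2.14 applies it; and the displayed sequence of the printed proof is not exact on the right for this `W`:
`M₀ = k·e₂`, `End_R(W/M₀) = M₂(k)` has length `4`, while every endomorphism of `W` acts on `W/M₀` as the scalar `a`
(`endo_apply`; the printed equality would give `length(End_R W) = 4 + 2 = 6 ≠ 3`).

## Scope notes on the FIRST sentence (BY NAME, nothing of this is formalised here)

* It is FALSE for general local rings: a local maximal commutative subalgebra `A ⊂ M₁₄(K)` of dimension `13` exists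
  [Courter1965] (and one of dimension `< n` in `M_n(K)` for every `n ≥ 14`, [NowakKepczyk2026CourterBounds] Thm. 25, with
  `dim A ≥ n` for all maximal commutative `A ⊂ M_n(K)`, `n ≤ 13`, ibid. abstract and Cor. 12); for `R = A`, `M = K¹⁴` one has
  `End_R(M) = C(A) = A` of length `13 < 14 = length(M)`. (The explicit `A = ℰ ⋆ ℰ ⊂ M₁₄` of ibid. §2.1 / Def. 21 — two
  stacked copies of the printed brick `ℰ` of Loewy signature `(2,5,2)` — was re-checked by exact linear algebra over `ℚ` in
  the cell `pub-hsemireg` (12 commuting generators, `dim A = dim C(A) = 13`); that computation is not part of this file.)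
* It is TRUE whenever `R` acts on `M ≅ kⁿ` through two commuting endomorphisms `X, Y` (i.e. `R/ann(M)` is generated by
  two elements over an algebraically closed `k` — the case of PROPOSITION 2.14: `R = 𝒪_{S,s}` at a CLOSED point `s` of a
  smooth surface `S` over `k`, residue field `κ(s) = k`; the lengths of the finite-length sheaf `M = Ẽ/E` and of `𝓔nd(M)`
  are the sums of these local lengths over the closed points of the support): `dim_k C(X, Y) ≥ n` because the variety of
  commuting pairs is irreducible [MotzkinTaussky1955] [Gerstenhaber1961], the condition `dim C(X, Y) ≥ n` is closed, and
  it holds on the dense set where `X` is regular (`C(X, Y) = k[X]`, dimension `n`) — a one-paragraph DERIVATION from the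
  cited irreducibility, recorded ×0, not a quoted sentence. So the INEQUALITY of PROPOSITION 2.14 stands on that theorem;
  its clause «`M` is isomorphic to `𝒪_S/𝒥`» rests on the refuted sentence (this file does not claim that clause false for
  `M = Ẽ/E` in an equality case — only that the printed route to it is void).

## References

* [Mukai1987ModuliBundlesK3] S. Mukai, On the moduli space of bundles on K3 surfaces. I, Tata Inst. Fund. Res. Stud. Math.
  11 (1987), LEMMA 2.13 p. 358, proof pp. 358–359, COROLLARY 2.12 p. 358, PROPOSITION 2.14 p. 359.
* [Courter1965] R. C. Courter, The dimension of maximal commutative subalgebras of `K_n`, Duke Math. J. 32 (1965) 225–232.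
* [NowakKepczyk2026CourterBounds] M. Nowak-Kępczyk, Minimal dimensions of maximal commutative matrix algebras and sharp
  Courter-type bounds, arXiv:2605.01387 (2026), abstract and Thm. 25.
* [MotzkinTaussky1955] T. S. Motzkin, O. Taussky, Pairs of matrices with property L. II, Trans. AMS 80 (1955) 387–401.
* [Gerstenhaber1961] M. Gerstenhaber, On dominance and varieties of commuting matrices, Ann. of Math. 73 (1961) 324–348.
* [Fulton1998] W. Fulton, Intersection Theory, App. A.1 (length = dimension over the residue field; via `LengthEqFinrank`).
-/

namespace Literature.RingTheory.Length

namespace Mukai1987Lemma213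

open TrivSqZeroExt IsLocalRing Module

variable (k : Type*) [Field k]

/-- The local `k`-algebra `R = k ⊕ k²` with square-zero augmentation ideal (`k[x, y]/(x, y)²`), as Mathlib's trivial
square-zero extension of `k` by `k²`. [folklore] -/
abbrev R : Type _ := TrivSqZeroExt k (Fin 2 → k)

/-- The carrier `W = k³` of the counterexample module (abstractly the Matlis dual `Hom_k(R, k)` of `R`). [folklore] -/
def W : Type _ := Fin 3 → k

/-- `W = k³` as an additive group (inherited). [folklore] -/
instance : AddCommGroup (W k) := inferInstanceAs (AddCommGroup (Fin 3 → k))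

/-- `W = k³` as a `k`-vector space (inherited). [folklore] -/
instance : Module k (W k) := inferInstanceAs (Module k (Fin 3 → k))

/-- `W = k³` is finite-dimensional over `k` (inherited). [folklore] -/
instance : Module.Finite k (W k) := inferInstanceAs (Module.Finite k (Fin 3 → k))

variable {k}

/-- Coordinates of a vector of `W = k³`. [folklore] -/
def W.coord (m : W k) (i : Fin 3) : k := (show Fin 3 → k from m) i

/-- The standard basis vector `eᵢ` of `W = k³`. [folklore] -/
def W.e (i : Fin 3) : W k := (Pi.single i (1 : k) : Fin 3 → k)

/-- Coordinates are additive. [folklore] -/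
@[simp] private theorem W.coord_add (m m' : W k) (i : Fin 3) : (m + m').coord i = m.coord i + m'.coord i := rfl

/-- Coordinates of `0`. [folklore] -/
@[simp] private theorem W.coord_zero (i : Fin 3) : (0 : W k).coord i = 0 := rfl

/-- Coordinates of `-m`. [folklore] -/
@[simp] private theorem W.coord_neg (m : W k) (i : Fin 3) : (-m).coord i = -m.coord i := rfl

/-- Coordinates of a `k`-multiple. [folklore] -/
@[simp] private theorem W.coord_smul (c : k) (m : W k) (i : Fin 3) : (c • m).coord i = c * m.coord i := rfl

/-- Coordinates of the basis vectors: `(eᵢ)ⱼ = δᵢⱼ`. [folklore] -/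
@[simp] private theorem W.coord_e (i j : Fin 3) : (W.e i : W k).coord j = if j = i then 1 else 0 := by
  simp only [W.coord, W.e, Pi.single_apply]

omit [Field k] in
/-- Two vectors of `W` with the same coordinates are equal. [folklore] -/
private theorem W.ext {m m' : W k} (h : ∀ i, m.coord i = m'.coord i) : m = m' := funext h

/-- Every vector of `W` is the `k`-combination of the basis vectors with its coordinates. [folklore] -/
private theorem W.eq_sum (m : W k) : m = m.coord 0 • W.e 0 + m.coord 1 • W.e 1 + m.coord 2 • W.e 2 := by
  refine W.ext fun i => ?_
  fin_cases i <;> simp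

/-- The vector of `W` with prescribed coordinates `(a, b, c)`. [folklore] -/
def W.mk (a b c : k) : W k := a • W.e 0 + b • W.e 1 + c • W.e 2

/-- `(a, b, c)₀ = a`. [folklore] -/
@[simp] private theorem W.coord_mk_zero (a b c : k) : (W.mk a b c).coord 0 = a := by simp [W.mk]

/-- `(a, b, c)₁ = b`. [folklore] -/
@[simp] private theorem W.coord_mk_one (a b c : k) : (W.mk a b c).coord 1 = b := by simp [W.mk]

/-- `(a, b, c)₂ = c`. [folklore] -/
@[simp] private theorem W.coord_mk_two (a b c : k) : (W.mk a b c).coord 2 = c := by simp [W.mk]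

/-! ### The `R`-module structure `(a, s) • m = a·m + (s₀ m₀ + s₁ m₁)·e₂` -/

/-- The action of `R = k ⊕ k²` on `W = k³`: the scalar part acts by scaling, the square-zero part `(s₀, s₁)` by the
nilpotent matrix `s₀ E₃₁ + s₁ E₃₂`. [folklore] -/
instance : SMul (R k) (W k) :=
  ⟨fun r m => r.fst • m + (r.snd 0 * m.coord 0 + r.snd 1 * m.coord 1) • W.e 2⟩

/-- The action unfolded: `(a, s) • m = a·m + (s₀ m₀ + s₁ m₁)·e₂`. [folklore] -/
private theorem smul_def (r : R k) (m : W k) :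
    r • m = r.fst • m + (r.snd 0 * m.coord 0 + r.snd 1 * m.coord 1) • W.e 2 := rfl

/-- Coordinate `0` of `r • m` is `(fst r) m₀`. [folklore] -/
@[simp] private theorem coord_smul_zero (r : R k) (m : W k) : (r • m).coord 0 = r.fst * m.coord 0 := by
  simp [smul_def]

/-- Coordinate `1` of `r • m` is `(fst r) m₁`. [folklore] -/
@[simp] private theorem coord_smul_one (r : R k) (m : W k) : (r • m).coord 1 = r.fst * m.coord 1 := by
  simp [smul_def]

/-- Coordinate `2` of `r • m` is `(fst r) m₂ + s₀ m₀ + s₁ m₁`. [folklore] -/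
@[simp] private theorem coord_smul_two (r : R k) (m : W k) :
    (r • m).coord 2 = r.fst * m.coord 2 + (r.snd 0 * m.coord 0 + r.snd 1 * m.coord 1) := by
  simp [smul_def]

/-- `snd (r * r')` coordinatewise in the commutative square-zero extension. [folklore] -/
private theorem snd_mul_apply (r r' : R k) (i : Fin 2) : (r * r').snd i = r.fst * r'.snd i + r'.fst * r.snd i := by
  rw [TrivSqZeroExt.snd_mul, op_smul_eq_smul]
  simp

/-- `W` is an `R`-module. [folklore] -/
instance : Module (R k) (W k) where
  one_smul m := W.ext fun i => by fin_cases i <;> simp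
  mul_smul r r' m := W.ext fun i => by
    fin_cases i <;> simp [TrivSqZeroExt.fst_mul, snd_mul_apply] <;> ring
  smul_zero r := W.ext fun i => by fin_cases i <;> simp
  smul_add r m m' := W.ext fun i => by fin_cases i <;> simp <;> ring
  add_smul r r' m := W.ext fun i => by fin_cases i <;> simp <;> ring
  zero_smul m := W.ext fun i => by fin_cases i <;> simp

/-- The `k`- and `R`-structures on `W` are compatible. [folklore] -/
instance : IsScalarTower k (R k) (W k) :=
  ⟨fun c r m => W.ext fun i => by fin_cases i <;> simp [TrivSqZeroExt.fst_smul, TrivSqZeroExt.snd_smul] <;> ring⟩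

/-! ### `R` is local with residue field `k`; lengths over `R` are dimensions over `k` -/

/-- `R = k ⊕ k²` (square-zero) is a local ring: an element is a unit iff its scalar part is nonzero. [folklore] -/
instance isLocalRing : IsLocalRing (R k) := by
  refine IsLocalRing.of_isUnit_or_isUnit_one_sub_self fun a => ?_
  by_cases h : a.fst = 0
  · refine Or.inr (TrivSqZeroExt.isUnit_iff_isUnit_fst.mpr ?_)
    rw [TrivSqZeroExt.fst_sub, TrivSqZeroExt.fst_one, h, sub_zero]
    exact isUnit_one
  · exact Or.inl (TrivSqZeroExt.isUnit_iff_isUnit_fst.mpr (Ne.isUnit h))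

/-- Every element of `R` is congruent to the scalar `fst r` modulo the maximal ideal (the residue field of `R` is `k`).
[folklore] -/
private theorem exists_sub_algebraMap_mem_maximalIdeal (r : R k) :
    ∃ c : k, r - algebraMap k (R k) c ∈ maximalIdeal (R k) := by
  refine ⟨r.fst, ?_⟩
  rw [IsLocalRing.mem_maximalIdeal, mem_nonunits_iff, TrivSqZeroExt.isUnit_iff_isUnit_fst,
    TrivSqZeroExt.algebraMap_eq_inl, TrivSqZeroExt.fst_sub, TrivSqZeroExt.fst_inl, sub_self]
  exact not_isUnit_zero

/-- `R` is finite-dimensional over `k` (it is `k × k²` as a `k`-module). [folklore] -/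
instance : Module.Finite k (R k) := inferInstanceAs (Module.Finite k (k × (Fin 2 → k)))

/-- `dim_k R = 3`. [folklore] -/
private theorem finrank_R : Module.finrank k (R k) = 3 := by
  change Module.finrank k (k × (Fin 2 → k)) = 3
  rw [Module.finrank_prod, Module.finrank_self, Module.finrank_fin_fun]

/-- `dim_k W = 3`. [folklore] -/
private theorem finrank_W : Module.finrank k (W k) = 3 := by
  change Module.finrank k (Fin 3 → k) = 3
  exact Module.finrank_fin_fun k

/-- `length_R(R) = 3`. [folklore] -/
private theorem length_R : Module.length (R k) (R k) = 3 := by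
  rw [length_eq_finrank_of_residueField exists_sub_algebraMap_mem_maximalIdeal (R k), finrank_R]
  rfl

/-- `length_R(W) = 3` (the `length(M)` of [cite: Mukai1987ModuliBundlesK3, Lemma 2.13, p. 358] for `M = W`). -/
theorem length_W : Module.length (R k) (W k) = 3 := by
  rw [length_eq_finrank_of_residueField exists_sub_algebraMap_mem_maximalIdeal (W k), finrank_W]
  rfl

/-- `W` is an artinian `R`-module (it has finite length), as in the hypothesis of
[cite: Mukai1987ModuliBundlesK3, Lemma 2.13, p. 358]. -/
theorem isArtinian_W : IsArtinian (R k) (W k) := by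
  have h : Module.length (R k) (W k) ≠ ⊤ := by rw [length_W]; exact ENat.coe_ne_top 3
  exact ((isFiniteLength_iff_isNoetherian_isArtinian.mp (Module.length_ne_top_iff.mp h))).2

/-! ### Every `R`-endomorphism of `W` is the action of an element of `R` -/

/-- The square-zero element `εᵢ = (0, eᵢ)` of `R` acts on `W` by `m ↦ mᵢ · e₂` (`i = 0, 1`). [folklore] -/
private theorem inr_single_smul (i : Fin 2) (m : W k) :
    (TrivSqZeroExt.inr (Pi.single i (1 : k)) : R k) • m = m.coord ⟨i, by omega⟩ • W.e 2 := by
  refine W.ext fun j => ?_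
  fin_cases i <;> fin_cases j <;> simp

/-- An `R`-linear endomorphism of `W` is `k`-linear. [folklore] -/
private theorem endo_map_smul (φ : W k →ₗ[R k] W k) (c : k) (m : W k) : φ (c • m) = c • φ m := by
  rw [← algebraMap_smul (R k) c m, φ.map_smul, algebraMap_smul]

/-- **Normal form of the `R`-endomorphisms of `W`.** Every `R`-linear `φ : W → W` is
`m ↦ a·m + (c₁ m₀ + c₂ m₁)·e₂` with `a = (φ e₀)₀`, `c₁ = (φ e₀)₂`, `c₂ = (φ e₁)₂`; in matrix terms the commutant of
`{E₃₁, E₃₂}` in `M₃(k)` is `k·1 + k·E₃₁ + k·E₃₂` — the computation of `End_R(M)` for the `M = W` of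
[cite: Mukai1987ModuliBundlesK3, Lemma 2.13, p. 358]. -/
theorem endo_apply (φ : W k →ₗ[R k] W k) (m : W k) :
    φ m = (φ (W.e 0)).coord 0 • m + ((φ (W.e 0)).coord 2 * m.coord 0 + (φ (W.e 1)).coord 2 * m.coord 1) • W.e 2 := by
  -- the relations imposed by `R`-linearity with respect to `ε₀ = (0, e₀)` and `ε₁ = (0, e₁)`
  have h0 : ∀ m : W k, φ (m.coord 0 • W.e 2) = (φ m).coord 0 • W.e 2 := fun m => by
    have := φ.map_smul (TrivSqZeroExt.inr (Pi.single 0 (1 : k)) : R k) m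
    rwa [inr_single_smul, inr_single_smul] at this
  have h1 : ∀ m : W k, φ (m.coord 1 • W.e 2) = (φ m).coord 1 • W.e 2 := fun m => by
    have := φ.map_smul (TrivSqZeroExt.inr (Pi.single 1 (1 : k)) : R k) m
    rwa [inr_single_smul, inr_single_smul] at this
  -- `φ e₂ = (φ e₀)₀ · e₂`, `φ e₂ = (φ e₁)₁ · e₂`, `(φ e₁)₀ = 0`, `(φ e₀)₁ = 0`
  have he2 : φ (W.e 2) = (φ (W.e 0)).coord 0 • W.e 2 := by simpa using h0 (W.e 0)
  have he2' : φ (W.e 2) = (φ (W.e 1)).coord 1 • W.e 2 := by simpa using h1 (W.e 1)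
  have h10 : (φ (W.e 1)).coord 0 = 0 := by
    have := congrArg (fun v : W k => v.coord 2) (h0 (W.e 1))
    simpa using this.symm
  have h01 : (φ (W.e 0)).coord 1 = 0 := by
    have := congrArg (fun v : W k => v.coord 2) (h1 (W.e 0))
    simpa using this.symm
  have h11 : (φ (W.e 1)).coord 1 = (φ (W.e 0)).coord 0 := by
    have := congrArg (fun v : W k => v.coord 2) (he2.symm.trans he2')
    simpa using this.symm
  -- expand `m` on the basis and compare coordinates
  conv_lhs => rw [W.eq_sum m]
  rw [map_add, map_add, endo_map_smul, endo_map_smul, endo_map_smul, he2]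
  refine W.ext fun i => ?_
  fin_cases i <;> simp [h10, h01, h11] <;> ring

/-- **The endomorphism induced on `W/M₀` is a scalar** (`M₀ = k·e₂` the socle; `W/M₀` has basis `ē₀, ē₁`): for every
`R`-linear `φ`, `(φ e₀)₁ = 0`, `(φ e₁)₀ = 0` and `(φ e₁)₁ = (φ e₀)₀`. Hence the image of `End_R(W) → End_R(W/M₀) = M₂(k)`
(length `4`) is `k·1` (length `1`), and the display «`0 → Hom_R(M, M₀) → End_R(M) → End_R(M/M₀) → 0`» in the proof of
[cite: Mukai1987ModuliBundlesK3, Lemma 2.13 (proof), p. 358] is not exact on the right for `M = W`. -/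
theorem endo_induced_scalar (φ : W k →ₗ[R k] W k) :
    (φ (W.e 0)).coord 1 = 0 ∧ (φ (W.e 1)).coord 0 = 0 ∧ (φ (W.e 1)).coord 1 = (φ (W.e 0)).coord 0 := by
  refine ⟨?_, ?_, ?_⟩
  · have := congrArg (fun v : W k => v.coord 1) (endo_apply φ (W.e 0))
    simpa using this
  · have := congrArg (fun v : W k => v.coord 0) (endo_apply φ (W.e 1))
    simpa using this
  · have := congrArg (fun v : W k => v.coord 1) (endo_apply φ (W.e 1))
    simpa using this

/-- The action map `r ↦ (m ↦ r • m)`, `R → End_R(W)`, is injective (`W` is a faithful `R`-module). [folklore] -/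
private theorem lsmul_injective : Function.Injective (LinearMap.lsmul (R k) (W k)) := by
  intro r r' h
  have h' : ∀ m : W k, r • m = r' • m := fun m => by
    simpa using congrArg (fun f : W k →ₗ[R k] W k => f m) h
  refine TrivSqZeroExt.ext ?_ (funext fun i => ?_)
  · simpa using congrArg (fun v : W k => v.coord 0) (h' (W.e 0))
  · fin_cases i
    · simpa using congrArg (fun v : W k => v.coord 2) (h' (W.e 0))
    · simpa using congrArg (fun v : W k => v.coord 2) (h' (W.e 1))

/-- The action map `R → End_R(W)` is surjective: by `endo_apply`, `φ` is the action of
`(a, (c₁, c₂)) = ((φ e₀)₀, ((φ e₀)₂, (φ e₁)₂))`. [folklore] -/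
private theorem lsmul_surjective : Function.Surjective (LinearMap.lsmul (R k) (W k)) := by
  intro φ
  refine ⟨(TrivSqZeroExt.inl ((φ (W.e 0)).coord 0) +
    TrivSqZeroExt.inr (Pi.single 0 ((φ (W.e 0)).coord 2) + Pi.single 1 ((φ (W.e 1)).coord 2)) : R k), ?_⟩
  refine LinearMap.ext fun m => ?_
  rw [LinearMap.lsmul_apply, endo_apply φ m, smul_def]
  simp

/-- **`End_R(W) ≅ R` as `R`-modules**, via the action map. [folklore] -/
noncomputable def lsmulEquiv : R k ≃ₗ[R k] (W k →ₗ[R k] W k) :=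
  LinearEquiv.ofBijective (LinearMap.lsmul (R k) (W k)) ⟨lsmul_injective, lsmul_surjective⟩

/-- **`length_R(End_R(W)) = 3`** (the `length(End_R(M))` of [cite: Mukai1987ModuliBundlesK3, Lemma 2.13, p. 358] for `M = W`). -/
theorem length_end_W : Module.length (R k) (W k →ₗ[R k] W k) = 3 := by
  rw [← (lsmulEquiv (k := k)).length_eq, length_R]

/-- **EQUALITY holds in the first sentence of LEMMA 2.13 for `M = W`:** `length_R(End_R(W)) = length_R(W)` (`= 3`).
[cite: Mukai1987ModuliBundlesK3, Lemma 2.13, p. 358] -/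
theorem length_end_W_eq_length_W : Module.length (R k) (W k →ₗ[R k] W k) = Module.length (R k) (W k) := by
  rw [length_end_W, length_W]

/-! ### `W` is not cyclic -/

/-- **`W` is not a cyclic `R`-module**: no single vector `v` has `R • v = W` (from `e₀ = r • v`, `e₁ = s • v` one gets
`fst r · v₀ = 1`, `fst r · v₁ = 0`, `fst s · v₁ = 1`, impossible) — so the conclusion «`M` is isomorphic to `R/I`» of
[cite: Mukai1987ModuliBundlesK3, Lemma 2.13, p. 358] fails for `M = W`. -/
theorem not_isCyclic_W (v : W k) : ¬ ∀ m : W k, ∃ r : R k, r • v = m := by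
  intro h
  obtain ⟨r, hr⟩ := h (W.e 0)
  obtain ⟨s, hs⟩ := h (W.e 1)
  have h00 : r.fst * v.coord 0 = 1 := by simpa using congrArg (fun w : W k => w.coord 0) hr
  have h01 : r.fst * v.coord 1 = 0 := by simpa using congrArg (fun w : W k => w.coord 1) hr
  have h11 : s.fst * v.coord 1 = 1 := by simpa using congrArg (fun w : W k => w.coord 1) hs
  have hr0 : r.fst ≠ 0 := fun h0 => by simp [h0] at h00
  have hv1 : v.coord 1 = 0 := (mul_eq_zero.mp h01).resolve_left hr0
  simp [hv1] at h11

/-- **For every ideal `I` of `R`, `W` is not isomorphic to `R/I`** (a quotient `R/I` is cyclic, `W` is not).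
[cite: Mukai1987ModuliBundlesK3, Lemma 2.13, p. 358] -/
theorem isEmpty_linearEquiv_quotient (I : Ideal (R k)) : IsEmpty (W k ≃ₗ[R k] (R k ⧸ I)) := by
  refine ⟨fun e => not_isCyclic_W (e.symm (Ideal.Quotient.mk I 1)) fun m => ?_⟩
  obtain ⟨r, hr⟩ := Ideal.Quotient.mk_surjective (e m)
  refine ⟨r, ?_⟩
  rw [← LinearEquiv.map_smul]
  have : r • (Ideal.Quotient.mk I 1) = Ideal.Quotient.mk I r := by
    simp only [← Ideal.Quotient.mk_eq_mk, ← Submodule.Quotient.mk_smul, smul_eq_mul, mul_one]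
  rw [this, hr, LinearEquiv.symm_apply_apply]

/-- **The equality clause of [Muk87-K3] LEMMA 2.13 fails**: over the local ring `R = k ⊕ k²` (square zero), the artinian
module `W = k³` has `length(End_R(W)) = length(W)` and yet is isomorphic to no `R/I`.
[cite: Mukai1987ModuliBundlesK3, Lemma 2.13, p. 358] -/
theorem Mukai1987_lemma_2_13_equality_clause_fails :
    IsLocalRing (R k) ∧ IsArtinian (R k) (W k) ∧
      Module.length (R k) (W k →ₗ[R k] W k) = Module.length (R k) (W k) ∧
      ∀ I : Ideal (R k), IsEmpty (W k ≃ₗ[R k] (R k ⧸ I)) :=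
  ⟨isLocalRing, isArtinian_W, length_end_W_eq_length_W, isEmpty_linearEquiv_quotient⟩

end Mukai1987Lemma213

end Literature.RingTheory.Length
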